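import Literature.NumberTheory.IwasawaTheory.PSFiniteSlopeSelmer
import Literature.NumberTheory.EllipticCurves.PAdicBSDSplitMultiplicativeProofs
import Literature.NumberTheory.EllipticCurves.PAdicGrossZagierConstantTermProofs
import Literature.NumberTheory.EllipticCurves.CuspFormLFunctionLevelConductorProofs
import Literature.NumberTheory.EllipticCurves.ModularityVersionApProofs
import Literature.NumberTheory.EllipticCurves.ModularDegreeQuadraticTwistProofs
import Literature.NumberTheory.EllipticCurves.LeadingTermPPartProofs
import Literature.NumberTheory.EllipticCurves.GrossZagierRationalPoint
import Literature.NumberTheory.EllipticCurves.Rank1Residual.Predicates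
import HarnessLib

/-!
# The value at the trivial character of the untwisted (principal-series) `3`-adic `L`-function:
# `𝓛^η_W(𝟙) = 9 η(−1) α⁻² · [0]⁺_{f_W}` — kernel supply for crux K1 `PSRankOneLowerHalfAtThree`
# (route `CyclotomicUntwist`, item stmt-BirchSwinnertonDyer-21580), in the currency of D1
# (`Literature.NumberTheory.IwasawaTheory.PSCyclotomicLFunction`)

HONEST FRAMING. Helper theorems only (`--supports stmt-BirchSwinnertonDyer-21580`); nothing here closes
the crux, and BSD is not proved by any of this. What is proved: for the untwist datum `(W, η, α)` of
the route — `W/ℚ` with ADDITIVE reduction at `3` (so `a₃(f_W) = 0`, `3 ∣` level), `η` a PRIMITIVE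
Dirichlet character mod `9` (order `3` or `6`), any `α ∈ ℂ₃`, and ANY ball system `𝓛` with D1's
property `IsPSCyclotomicLFunctionOf W η α 𝓛` — the value at the trivial character is

  `𝓛(𝟙) = gammaCharValue 3 𝓛 1 = 𝓛 0 0 = c₀(𝓛) = α⁻² · 9 η(−1) · [0]⁺_{f_W}`,

where `[0]⁺_f = ratPlusSymbol f 0 = L(E,1)/Ω⁺_f` (Mazur–Tate–Teitelbaum §I.8). Consequences:
(i) in analytic rank `≥ 1` (`L(E,1) = 0`), `𝓛(𝟙) = 0`, i.e. the Amice transform of `𝓛` vanishes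
at `T = 0` — the order-`≥ 1` input of every leading-term reading of the crux (GZ₃ / READ items of
the planned re-line); (ii) the INTERPOLATION FACTOR AT `𝟙` IS `9 η(−1) α⁻²`, NON-ZERO for `α ≠ 0`:
there is no exceptional zero on the principal-series rows (route KILL CRITERION (iii), now a kernel
theorem: `𝓛(𝟙) = 0 ↔ L(E,1) = 0` for `α ≠ 0`).

THE COMPUTATION (§4; pure finite algebra behind the route text's "`9 η(−1) α⁻² · L(E,1)/Ω⁺_E`").
D1's interpolation clause at `ξ = 𝟙` reads `𝓛(𝟙) = e₂(α) · ∑_{a,b mod 9} η̄(a) η(b) [(a+b)/9]⁺_f`,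
`e₂(α) = α⁻²` (the primitive character of `η̄·𝟙` is `η̄`, conductor `9`). Grouping by `c = a + b`,
`J(c) = ∑_a η̄(a) η(c − a)` vanishes for `c` a unit (`= 1 + η(4) + η(7) = 1 + ζ + ζ²`, `ζ = η(2)²` a
PRIMITIVE cube root of unity exactly because `η` is primitive mod `9`), `J(0) = 6 η(−1)`,
`J(3) = J(6) = 3(η(2) + η(5))`; with the `U₃`-relation `a₃ [r]⁺ = ∑_j [(r+j)/3]⁺` (`3 ∣ N`, MTT §I.4)
and `a₃(f_W) = 0` at `r = 0`, `[1/3]⁺ + [2/3]⁺ = −[0]⁺`, whence `9 η(−1) [0]⁺`. In the kernel the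
double sum is expanded over `(ℤ/9)²` (81 terms) after tabulating `η`, `η̄` in powers of `z = η(2)`,
and closed by one `linear_combination` of `[0]⁺+[1/3]⁺+[2/3]⁺ = 0`, `1 + z² + z⁴ = 0`, `z⁶ = 1`.

References: Mazur–Tate–Teitelbaum 1986 §I.4 (4.2), §I.8, §I.14 [MazurTateTeitelbaum1986Invent];
Bellaïche 2021 Thm. 6.7.9 [Bellaiche2021]; Atkin–Lehner 1970 Thm. 3 [AtkinLehner1970].
-/

noncomputable section

open scoped MatrixGroups

open CongruenceSubgroup DirichletCharacter WeierstrassCurve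
  Literature.NumberTheory.EllipticCurves Literature.NumberTheory.EllipticCurves.ModularForms
  Literature.NumberTheory.EllipticCurves.Rank1Residual Literature.NumberTheory.IwasawaTheory

-- D-0017 layout: summit = sub-problem ⇒ namespace `Summit.BirchSwinnertonDyer.BirchSwinnertonDyer.…`.
set_option linter.dupNamespace false

namespace Summit.BirchSwinnertonDyer.BirchSwinnertonDyer.Theorems.CyclotomicUntwistValueAtOne

/-! ### §1 Finite bookkeeping on `ℤ/9` -/

section ZModNine

/-- `3² = 9` (so that `ZMod (3 ^ 2)` computes to `Fin 9`). [folklore] -/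
theorem three_sq : (3 : ℕ) ^ 2 = 9 := by norm_num
/-- A sum over `ℤ/9` is the sum over the representatives `0, …, 8`. [folklore] -/
theorem sum_univ_zmod_nine {M : Type*} [AddCommMonoid M] (g : ZMod (3 ^ 2) → M) :
    ∑ a : ZMod (3 ^ 2), g a = ∑ i ∈ Finset.range 9, g (i : ZMod (3 ^ 2)) := by
  rw [← Fin.sum_univ_eq_sum_range (fun i : ℕ ↦ g (i : ZMod (3 ^ 2))) 9]
  change ∑ a : ZMod 9, g a = ∑ i : ZMod 9, g ((ZMod.val i : ℕ) : ZMod 9)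
  exact Finset.sum_congr rfl fun a _ ↦ by rw [ZMod.natCast_zmod_val]

/-- `[m/9]⁺_f` depends only on `m mod 9` (`[r + n]⁺ = [r]⁺`). [cite: MazurTateTeitelbaum1986Invent, §I.8] -/
theorem ratPlusSymbol_natCast_div_nine {N : ℕ} [NeZero N] (f : CuspForm (Gamma0 N) 2) (m : ℕ) :
    ratPlusSymbol f ((m : ℚ) / 9) = ratPlusSymbol f (((m % 9 : ℕ) : ℚ) / 9) := by
  have h : ((m % 9 : ℕ) : ℚ) + 9 * ((m / 9 : ℕ) : ℚ) = (m : ℚ) := by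
    exact_mod_cast Nat.mod_add_div m 9
  have hm : (m : ℚ) / 9 = ((m % 9 : ℕ) : ℚ) / 9 + (((m / 9 : ℕ) : ℤ) : ℚ) := by
    rw [Int.cast_natCast, ← h]
    ring
  rw [hm, ratPlusSymbol_add_intCast_eq]

/-- The symbol in D1's double sum: `[a/9 + b/9]⁺_f = [((a + b) mod 9)/9]⁺_f` for `a, b ∈ ℤ/9`
represented in `[0, 9)`. [cite: MazurTateTeitelbaum1986Invent, §I.8] -/
theorem ratPlusSymbol_val_add_val {N : ℕ} [NeZero N] (f : CuspForm (Gamma0 N) 2)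
    (a b : ZMod (3 ^ 2)) :
    ratPlusSymbol f ((a.val : ℚ) / ((3 : ℕ) : ℚ) ^ 2 + (b.val : ℚ) / ((3 : ℕ) : ℚ) ^ 2) =
      ratPlusSymbol f ((((a.val + b.val) % 9 : ℕ) : ℚ) / 9) := by
  have h : (a.val : ℚ) / ((3 : ℕ) : ℚ) ^ 2 + (b.val : ℚ) / ((3 : ℕ) : ℚ) ^ 2 =
      ((a.val + b.val : ℕ) : ℚ) / 9 := by
    push_cast
    ring
  rw [h, ratPlusSymbol_natCast_div_nine]

end ZModNine

/-! ### §2 The character tables on `ℤ/9` in powers of `z = η(2)` -/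

section Characters

variable (η : DirichletCharacter ℂ_[3] (3 ^ 2))

/-- `η` vanishes off the units of `ℤ/9`: `η(0) = η(3) = η(6) = 0`. [folklore] -/
theorem eta_nonunit :
    η ((0 : ℕ) : ZMod (3 ^ 2)) = 0 ∧ η ((3 : ℕ) : ZMod (3 ^ 2)) = 0 ∧
      η ((6 : ℕ) : ZMod (3 ^ 2)) = 0 :=
  ⟨η.map_nonunit (by decide), η.map_nonunit (by decide), η.map_nonunit (by decide)⟩

/-- The units of `ℤ/9` are the powers of `2`: `1, 2, 4, 8, 7, 5 = 2⁰, …, 2⁵`, so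
`η(1) = 1, η(4) = z², η(8) = z³, η(7) = z⁴, η(5) = z⁵` with `z = η(2)`, and `z⁶ = 1`. [folklore] -/
theorem eta_table :
    η ((1 : ℕ) : ZMod (3 ^ 2)) = 1 ∧
    η ((2 : ℕ) : ZMod (3 ^ 2)) = η 2 ∧
    η ((4 : ℕ) : ZMod (3 ^ 2)) = η 2 ^ 2 ∧
    η ((5 : ℕ) : ZMod (3 ^ 2)) = η 2 ^ 5 ∧
    η ((7 : ℕ) : ZMod (3 ^ 2)) = η 2 ^ 4 ∧
    η ((8 : ℕ) : ZMod (3 ^ 2)) = η 2 ^ 3 ∧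
    η 2 ^ 6 = 1 := by
  have h1 : ((1 : ℕ) : ZMod (3 ^ 2)) = 1 := by decide
  have h2 : ((2 : ℕ) : ZMod (3 ^ 2)) = 2 := by decide
  have h4 : ((4 : ℕ) : ZMod (3 ^ 2)) = 2 ^ 2 := by decide
  have h5 : ((5 : ℕ) : ZMod (3 ^ 2)) = 2 ^ 5 := by decide
  have h7 : ((7 : ℕ) : ZMod (3 ^ 2)) = 2 ^ 4 := by decide
  have h8 : ((8 : ℕ) : ZMod (3 ^ 2)) = 2 ^ 3 := by decide
  have h6 : (2 : ZMod (3 ^ 2)) ^ 6 = 1 := by decide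
  refine ⟨by rw [h1, map_one], by rw [h2], by rw [h4, map_pow], by rw [h5, map_pow],
    by rw [h7, map_pow], by rw [h8, map_pow], by rw [← map_pow, h6, map_one]⟩

/-- The table of `η⁻¹ = η̄` (values in the field `ℂ₃`, `η⁻¹(a) = η(a)⁻¹`):
`η⁻¹(2) = z⁵, η⁻¹(4) = z⁴, η⁻¹(8) = z³, η⁻¹(7) = z², η⁻¹(5) = z`, `η⁻¹(1) = 1`, zero off the units.
[folklore] -/
theorem eta_inv_table :
    η⁻¹ ((0 : ℕ) : ZMod (3 ^ 2)) = 0 ∧ η⁻¹ ((3 : ℕ) : ZMod (3 ^ 2)) = 0 ∧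
    η⁻¹ ((6 : ℕ) : ZMod (3 ^ 2)) = 0 ∧
    η⁻¹ ((1 : ℕ) : ZMod (3 ^ 2)) = 1 ∧
    η⁻¹ ((2 : ℕ) : ZMod (3 ^ 2)) = η 2 ^ 5 ∧
    η⁻¹ ((4 : ℕ) : ZMod (3 ^ 2)) = η 2 ^ 4 ∧
    η⁻¹ ((5 : ℕ) : ZMod (3 ^ 2)) = η 2 ∧
    η⁻¹ ((7 : ℕ) : ZMod (3 ^ 2)) = η 2 ^ 2 ∧
    η⁻¹ ((8 : ℕ) : ZMod (3 ^ 2)) = η 2 ^ 3 := by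
  obtain ⟨e1, e2, e4, e5, e7, e8, e6⟩ := eta_table η
  obtain ⟨n0, n3, n6⟩ := eta_nonunit η
  simp only [MulChar.inv_apply_eq_inv', n0, n3, n6, e1, e2, e4, e5, e7, e8, inv_zero, inv_one]
  refine ⟨trivial, trivial, trivial, trivial, ?_, ?_, ?_, ?_, ?_⟩ <;>
    refine inv_eq_of_mul_eq_one_right ?_ <;> linear_combination e6

end Characters

/-! ### §3 Primitivity mod `9`: `z² = η(4)` is a primitive cube root of unity -/

section Primitive

variable (η : DirichletCharacter ℂ_[3] (3 ^ 2))

/-- The kernel of `(ℤ/9)^× → (ℤ/3)^×` is `{1, 4, 7}`. [folklore] -/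
theorem coe_eq_of_unitsMap_eq_one (x : (ZMod (3 ^ 2))ˣ)
    (hx : ZMod.unitsMap (show 3 ∣ 3 ^ 2 by norm_num) x = 1) :
    (x : ZMod (3 ^ 2)) = 1 ∨ (x : ZMod (3 ^ 2)) = (4 : ℕ) ∨ (x : ZMod (3 ^ 2)) = (7 : ℕ) := by
  revert hx
  revert x
  decide

/-- **A primitive character mod `9` does not kill `4`**: otherwise it is trivial on
`ker((ℤ/9)^× → (ℤ/3)^×) = ⟨4⟩` and factors through `3`, contradicting conductor `9`. [folklore] -/
theorem eta_four_ne_one (hη : η.IsPrimitive) : η ((4 : ℕ) : ZMod (3 ^ 2)) ≠ 1 := by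
  intro h4
  have h7 : η ((7 : ℕ) : ZMod (3 ^ 2)) = 1 := by
    have : ((7 : ℕ) : ZMod (3 ^ 2)) = ((4 : ℕ) : ZMod (3 ^ 2)) * ((4 : ℕ) : ZMod (3 ^ 2)) := by
      decide
    rw [this, map_mul, h4, one_mul]
  have hfac : η.FactorsThrough 3 := by
    rw [factorsThrough_iff_ker_unitsMap (hd := show 3 ∣ 3 ^ 2 by norm_num)]
    intro x hx
    rw [MonoidHom.mem_ker] at hx ⊢
    apply Units.ext
    rw [MulChar.coe_toUnitHom, Units.val_one]
    rcases coe_eq_of_unitsMap_eq_one x hx with h | h | h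
    · rw [h, map_one]
    · rw [h, h4]
    · rw [h, h7]
  have hdvd : η.conductor ∣ 3 :=
    (mem_conductorSet_iff_conductor_dvd η (show 3 ∣ 3 ^ 2 by norm_num)).mp hfac
  rw [hη] at hdvd
  revert hdvd
  decide

/-- For a primitive `η` mod `9` with `z = η(2)`: `1 + z² + z⁴ = 0` (`z²` is a primitive cube root
of unity: `(z²)³ = z⁶ = 1`, `z² = η(4) ≠ 1`). [folklore] -/
theorem one_add_sq_add_fourth_eq_zero (hη : η.IsPrimitive) : 1 + η 2 ^ 2 + η 2 ^ 4 = 0 := by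
  obtain ⟨-, -, e4, -, -, -, e6⟩ := eta_table η
  have hne : η 2 ^ 2 - 1 ≠ 0 := by
    rw [sub_ne_zero, ← e4]
    exact eta_four_ne_one η hη
  have hprod : (η 2 ^ 2 - 1) * (1 + η 2 ^ 2 + η 2 ^ 4) = 0 := by
    linear_combination e6
  exact (mul_eq_zero.mp hprod).resolve_left hne

end Primitive

/-! ### §4 The double symbol sum at `(η, η̄)`: `∑_{a,b} η̄(a) η(b) [(a+b)/9]⁺ = 9 η(−1) [0]⁺` -/

section SymbolSum

variable {N : ℕ} [NeZero N] (f : CuspForm (Gamma0 N) 2)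

/-- **The untwisted symbol sum at the trivial character.** For any `f ∈ S₂(Γ₀(N))` whose plus
symbols satisfy the `U₃`-relation with eigenvalue `0` at `r = 0`, `[0]⁺ + [1/3]⁺ + [2/3]⁺ = 0`
(`a₃(f) = 0`, `3 ∣ N`; Mazur–Tate–Teitelbaum §I.4 (4.2)), and a PRIMITIVE `η` mod `9`:
`untwistSymbolSum 3 f η η⁻¹ = ∑_{a,b mod 9} η̄(a) η(b) [a/9 + b/9]⁺_f = 9 η(−1) [0]⁺_f`.
Brute-force evaluation over `(ℤ/9)²` with the tables of §2 and the cyclotomic relation of §3.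
[cite: MazurTateTeitelbaum1986Invent, §I.4 (4.2) and §I.8] -/
theorem untwistSymbolSum_inv_eq (η : DirichletCharacter ℂ_[3] (3 ^ 2)) (hη : η.IsPrimitive)
    (hU : ratPlusSymbol f 0 + ratPlusSymbol f (1 / 3) + ratPlusSymbol f (2 / 3) = 0) :
    untwistSymbolSum 3 f η η⁻¹ = 9 * η (-1) * algebraMap ℚ ℂ_[3] (ratPlusSymbol f 0) := by
  obtain ⟨e1, e2, e4, e5, e7, e8, e6⟩ := eta_table η
  obtain ⟨-, n3, n6⟩ := eta_nonunit η
  obtain ⟨-, i3, i6, i1, i2, i4, i5, i7, i8⟩ := eta_inv_table η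
  have hz := one_add_sq_add_fourth_eq_zero η hη
  have hneg : η (-1) = η 2 ^ 3 := by rw [show (-1 : ZMod (3 ^ 2)) = ((8 : ℕ) : _) by decide, e8]
  unfold untwistSymbolSum
  simp only [ratPlusSymbol_val_add_val, sum_univ_zmod_nine]
  simp only [Finset.sum_range_succ, Finset.sum_range_zero, zero_add, ZMod.val_natCast, three_sq,
    Nat.reduceMod, Nat.reduceAdd]
  haveI : Fact (1 < 3 ^ 2) := ⟨by norm_num⟩ -- character values from §2, `η(−1) = z³`, `η 0 = 0`
  simp only [n3, n6, e1, e2, e4, e5, e7, e8, i1, i2, i3, i4, i5, i6, i7, i8, hneg,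
    Nat.cast_zero, zero_div, MulChar.map_zero, zero_mul, mul_zero, add_zero, one_mul]
  -- the `U₃`-relation at `r = 0` in `ℂ₃`
  have hU' : algebraMap ℚ ℂ_[3] (ratPlusSymbol f 0) +
      algebraMap ℚ ℂ_[3] (ratPlusSymbol f (((3 : ℕ) : ℚ) / 9)) +
      algebraMap ℚ ℂ_[3] (ratPlusSymbol f (((6 : ℕ) : ℚ) / 9)) = 0 := by
    have e36 : ((3 : ℕ) : ℚ) / 9 = 1 / 3 ∧ ((6 : ℕ) : ℚ) / 9 = 2 / 3 := by norm_num
    rw [e36.1, e36.2, ← map_add, ← map_add, hU, map_zero]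
  set z : ℂ_[3] := η 2 with hzdef
  set s0 : ℂ_[3] := algebraMap ℚ ℂ_[3] (ratPlusSymbol f 0) with hs0
  set s1 : ℂ_[3] := algebraMap ℚ ℂ_[3] (ratPlusSymbol f (((1 : ℕ) : ℚ) / 9)) with hs1
  set s2 : ℂ_[3] := algebraMap ℚ ℂ_[3] (ratPlusSymbol f (((2 : ℕ) : ℚ) / 9)) with hs2
  set s3 : ℂ_[3] := algebraMap ℚ ℂ_[3] (ratPlusSymbol f (((3 : ℕ) : ℚ) / 9)) with hs3
  set s4 : ℂ_[3] := algebraMap ℚ ℂ_[3] (ratPlusSymbol f (((4 : ℕ) : ℚ) / 9)) with hs4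
  set s5 : ℂ_[3] := algebraMap ℚ ℂ_[3] (ratPlusSymbol f (((5 : ℕ) : ℚ) / 9)) with hs5
  set s6 : ℂ_[3] := algebraMap ℚ ℂ_[3] (ratPlusSymbol f (((6 : ℕ) : ℚ) / 9)) with hs6
  set s7 : ℂ_[3] := algebraMap ℚ ℂ_[3] (ratPlusSymbol f (((7 : ℕ) : ℚ) / 9)) with hs7
  set s8 : ℂ_[3] := algebraMap ℚ ℂ_[3] (ratPlusSymbol f (((8 : ℕ) : ℚ) / 9)) with hs8
  linear_combination (z + 3 * z ^ 5 + 2 * z ^ 7) * hU' +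
    (-3 * z * s0 + s1 + s2 + s4 + s5 + s7 + s8) * hz +
    (s0 * (2 * z ^ 3 - 2 * z) + s1 * (z ^ 2 + 1) + s2 * z ^ 2 + s4 * (z ^ 2 + 1) + s5 +
      s7 * (z ^ 4 + 1) + s8) * e6

end SymbolSum

/-! ### §5 Curve level: `a₃(f_W) = 0`, the `U₃`-relation, and the value of `𝓛^η_W` at `𝟙` -/

section Curve

variable {W : WeierstrassCurve ℚ} [W.IsElliptic] {N : ℕ} [NeZero N] {f : CuspForm (Gamma0 N) 2}

/-- **`[0]⁺ + [1/3]⁺ + [2/3]⁺ = 0` for the newform of a curve ADDITIVE at `3`.** `3 ∣ N` (the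
level and the conductor have the same prime support, `IsNewformOf.dvd_level_iff_dvd_conductorNorm`;
`3 ∣ N_W` at a bad prime), `a₃(f) = a₃(W) = 0` (additive Euler factor `1`), and the `U₃`-relation
`a₃ [r]⁺ = ∑_{j mod 3} [(r + j)/3]⁺` at `r = 0` (Mazur–Tate–Teitelbaum §I.4 (4.2); Manin–Drinfeld
rationality `ratCast_ratPlusSymbol_holds`). [cite: MazurTateTeitelbaum1986Invent, §I.4 (4.2)] -/
theorem ratPlusSymbol_thirds_eq_zero_of_addv (hf : IsNewformOf W f) (hadd : Addv W 3) :
    ratPlusSymbol f 0 + ratPlusSymbol f (1 / 3) + ratPlusSymbol f (2 / 3) = 0 := by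
  have h3N : 3 ∣ N := (hf.dvd_level_iff_dvd_conductorNorm Nat.prime_three).mpr
    ((W.dvd_conductorNorm_iff_not_hasGoodReductionAtPrime 3).mpr hadd.1)
  have ha3 : cuspCoeff f 3 = ((0 : ℤ) : ℂ) := by
    rw [hf.2 3, W.LFunction_apply_eq_zero_of_not_good_of_not_mult 3 hadd.1 hadd.2 (dvd_refl 3)]
  have h := intCast_mul_ratPlusSymbol_of_dvd 3 hf.1 Nat.prime_three h3N ha3
    (ratCast_ratPlusSymbol_holds hf.1 hf.coeffField_eq_bot) 0
  rw [Int.cast_zero, zero_mul, Fin.sum_univ_three] at h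
  simp only [Fin.val_zero, Fin.val_one, Fin.val_two, Nat.cast_zero, Nat.cast_one, Nat.cast_ofNat,
    zero_add, zero_div] at h
  exact h.symm

variable (η : DirichletCharacter ℂ_[3] (3 ^ 2)) (α : ℂ_[3]) (𝓛 : (n : ℕ) → ZMod (3 ^ n) → ℂ_[3])

/-- The trivial character of `Γ` at level `3⁰` is primitive, even, of `3`-power order `3⁰`, and
`η⁻¹` is the primitive character of `η̄ · 𝟙` (conductor `9`) — the side conditions of D1's
interpolation clause at `ξ = 𝟙`. [cite: Bellaiche2021, Thm. 6.7.9] -/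
theorem interpolation_side_conditions_one (hη : η.IsPrimitive) :
    (1 : DirichletCharacter ℂ_[3] (3 ^ 0)).IsPrimitive ∧ (1 : DirichletCharacter ℂ_[3] (3 ^ 0)).Even ∧
    (∃ j : ℕ, orderOf (1 : DirichletCharacter ℂ_[3] (3 ^ 0)) = 3 ^ j) ∧ η⁻¹.IsPrimitive ∧
    (∀ a : ℕ, a.Coprime 3 → η⁻¹ (a : ZMod (3 ^ 2)) =
      (η (a : ZMod (3 ^ 2)))⁻¹ * (1 : DirichletCharacter ℂ_[3] (3 ^ 0)) (a : ZMod (3 ^ 0))) := by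
  have : Subsingleton (ZMod (3 ^ 0)) := by rw [pow_zero]; infer_instance
  refine ⟨?_, ?_, ⟨0, by rw [orderOf_one, pow_zero]⟩, ?_, fun a _ ↦ ?_⟩
  · rw [isPrimitive_def, conductor_one, pow_zero]
  · exact MulChar.one_apply (isUnit_of_subsingleton _)
  · rw [isPrimitive_def, conductor_inv]; exact hη
  · rw [MulChar.inv_apply_eq_inv', MulChar.one_apply (isUnit_of_subsingleton _), mul_one]

/-- **The value at `𝟙` of an untwisted `3`-adic `L`-function of `f` (D1's `IsUntwistedPAdicLFunction`)
when `[0]⁺ + [1/3]⁺ + [2/3]⁺ = 0` and `η` is primitive mod `9`**: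
`∫_Γ 𝟙 d𝓛 = e₂(α) · ∑_{a,b} η̄(a) η(b) [(a+b)/9]⁺ = α⁻² · 9 η(−1) · [0]⁺_f`.
[cite: MazurTateTeitelbaum1986Invent, §I.14 (case p ∣ N, a_p ≠ 0)] [cite: Bellaiche2021, Thm. 6.7.9] -/
theorem gammaCharValue_one_eq_of_isUntwisted (hη : η.IsPrimitive)
    (hU : ratPlusSymbol f 0 + ratPlusSymbol f (1 / 3) + ratPlusSymbol f (2 / 3) = 0)
    (h𝓛 : IsUntwistedPAdicLFunction 3 f η α 𝓛) :
    gammaCharValue 3 𝓛 (1 : DirichletCharacter ℂ_[3] (3 ^ 0)) =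
      α⁻¹ ^ 2 * (9 * η (-1) * algebraMap ℚ ℂ_[3] (ratPlusSymbol f 0)) := by
  obtain ⟨h1, h1e, h1o, hinv, hcompat⟩ := interpolation_side_conditions_one η hη
  rw [h𝓛.2.2 0 1 h1 h1e h1o 2 η⁻¹ hinv hcompat, untwistMultiplier_succ,
    untwistSymbolSum_inv_eq f η hη hU]

/-- **The value of `𝓛^η_W` at the trivial character (route `CyclotomicUntwist`, D1 currency).**
For `W/ℚ` additive at `3`, `η` primitive mod `9`, any `α` and any ball system `𝓛` with
`IsPSCyclotomicLFunctionOf W η α 𝓛`: the newform `f` of `W` (which exists by the predicate) has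
`𝓛(Γ) = 𝓛 0 0 = ∫_Γ 𝟙 d𝓛 = α⁻² · 9 η(−1) · [0]⁺_f`, where `[0]⁺_f · Ω⁺_f = L(W, 1)`
(`IsNewformOf.entireLFunction_one_eq`). The interpolation factor at `𝟙` is `9 η(−1) α⁻²`.
[cite: MazurTateTeitelbaum1986Invent, §I.14 (case p ∣ N, a_p ≠ 0)] [cite: Bellaiche2021, Thm. 6.7.9] -/
theorem value_at_one (h : IsPSCyclotomicLFunctionOf W η α 𝓛) (hadd : Addv W 3) (hη : η.IsPrimitive) :
    ∃ (N : ℕ) (_ : NeZero N) (f : CuspForm (Gamma0 N) 2), IsNewformOf W f ∧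
      𝓛 0 0 = α⁻¹ ^ 2 * (9 * η (-1) * algebraMap ℚ ℂ_[3] (ratPlusSymbol f 0)) ∧
      W.entireLFunction 1 = ((((ratPlusSymbol f 0 : ℚ) : ℝ) * plusPeriod f : ℝ) : ℂ) := by
  obtain ⟨N, hN, f, hf, h𝓛⟩ := h
  refine ⟨N, hN, f, hf, ?_, hf.entireLFunction_one_eq⟩
  rw [← gammaCharValue_one 𝓛]
  exact gammaCharValue_one_eq_of_isUntwisted η α 𝓛 hη
    (ratPlusSymbol_thirds_eq_zero_of_addv hf hadd) h𝓛

/-- **No exceptional zero on the principal-series rows, and vanishing at `𝟙` exactly when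
`L(W,1) = 0`** (route KILL CRITERION (iii) as a kernel theorem): for `W` additive at `3`, `η`
primitive mod `9`, `α ≠ 0` and `IsPSCyclotomicLFunctionOf W η α 𝓛`:
`𝓛(𝟙) = 0 ↔ L(W, 1) = 0` — the factor `9 η(−1) α⁻²` is non-zero and `Ω⁺_f > 0`.
[cite: MazurTateTeitelbaum1986Invent, §I.14 (case p ∣ N, a_p ≠ 0)] -/
theorem apply_zero_zero_eq_zero_iff (h : IsPSCyclotomicLFunctionOf W η α 𝓛) (hadd : Addv W 3)
    (hη : η.IsPrimitive) (hα : α ≠ 0) : 𝓛 0 0 = 0 ↔ W.entireLFunction 1 = 0 := by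
  obtain ⟨N, hN, f, hf, hval, hL⟩ := value_at_one η α 𝓛 h hadd hη
  have hper : 0 < plusPeriod f := IsNewform0.plusPeriod_pos_holds hf.1 hf.coeffField_eq_bot
  have hη1 : η (-1) ≠ 0 := by
    intro h0
    have h1 : η ((-1) * (-1)) = 1 := by rw [neg_one_mul, neg_neg, map_one]
    rw [map_mul, h0, zero_mul] at h1
    exact zero_ne_one h1
  have h9 : (9 : ℂ_[3]) ≠ 0 := by norm_num
  rw [hval, hL]
  constructor
  · intro h0
    have hs : algebraMap ℚ ℂ_[3] (ratPlusSymbol f 0) = 0 :=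
      ((mul_eq_zero.mp h0).resolve_left (pow_ne_zero 2 (inv_ne_zero hα)) |> mul_eq_zero.mp
        ).resolve_left (mul_ne_zero h9 hη1)
    have hs' : ratPlusSymbol f 0 = 0 := by
      rwa [map_eq_zero_iff _ (algebraMap ℚ ℂ_[3]).injective] at hs
    rw [hs']
    push_cast
    ring
  · intro h0
    have hs : ((ratPlusSymbol f 0 : ℚ) : ℝ) = 0 := by
      have h0' : (((ratPlusSymbol f 0 : ℚ) : ℝ) * plusPeriod f : ℝ) = 0 := by exact_mod_cast h0
      exact (mul_eq_zero.mp h0').resolve_right hper.ne'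
    have hs' : ratPlusSymbol f 0 = 0 := by exact_mod_cast hs
    rw [hs', map_zero, mul_zero, mul_zero]

/-- **In analytic rank `≥ 1` the untwisted `3`-adic `L`-function vanishes at `𝟙`**: for `W`
additive at `3` with `L(W, 1) = 0`, `η` primitive mod `9`, any `α`, and any `𝓛` with
`IsPSCyclotomicLFunctionOf W η α 𝓛`: `𝓛(Γ) = 𝓛 0 0 = 0`, `c₀(𝓛) = gammaMahlerCoeff 3 𝓛 0 = 0`,
`∫_Γ 𝟙 d𝓛 = 0`, and the Amice transform has positive order at `T = 0` (`1 ≤ gammaOrderAtOne 3 𝓛`)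
— the order-`≥ 1` input of the leading-term readings (GZ₃ / READ) of crux K1.
[cite: MazurTateTeitelbaum1986Invent, §I.13–§I.14] -/
theorem vanishing_at_one (h : IsPSCyclotomicLFunctionOf W η α 𝓛) (hadd : Addv W 3)
    (hη : η.IsPrimitive) (hL : W.entireLFunction 1 = 0) :
    𝓛 0 0 = 0 ∧ gammaMahlerCoeff 3 𝓛 0 = 0 ∧
      gammaCharValue 3 𝓛 (1 : DirichletCharacter ℂ_[3] (3 ^ 0)) = 0 ∧ 1 ≤ gammaOrderAtOne 3 𝓛 := by
  obtain ⟨N, hN, f, hf, hval, -⟩ := value_at_one η α 𝓛 h hadd hη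
  have h00 : 𝓛 0 0 = 0 := by
    rw [hval, ratPlusSymbol_zero_eq_zero_of_entireLFunction_eq_zero hf hL, map_zero, mul_zero,
      mul_zero]
  have hc0 : gammaMahlerCoeff 3 𝓛 0 = 0 := by
    rw [gammaMahlerCoeff_zero h.isGammaDistribution_and_hasGrowthOrder.1, h00]
  refine ⟨h00, hc0, by rw [gammaCharValue_one, h00], ?_⟩
  rw [gammaOrderAtOne_def]
  have h1 := PowerSeries.nat_le_order (gammaAmiceTransform 3 𝓛) 1 (fun i hi ↦ by
    obtain rfl : i = 0 := by omega
    rw [coeff_gammaAmiceTransform, hc0])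
  rwa [Nat.cast_one] at h1

/-- The rank-one rows of the crux: `ord_{s=1} L(W,s) = 1 ⇒ L(W,1) = 0 ⇒ 𝓛` vanishes at `𝟙`.
[cite: MazurTateTeitelbaum1986Invent, §I.13–§I.14] -/
theorem vanishing_at_one_of_analyticRank_eq_one (h : IsPSCyclotomicLFunctionOf W η α 𝓛)
    (hadd : Addv W 3) (hη : η.IsPrimitive) (hr : W.analyticRank = 1) :
    𝓛 0 0 = 0 ∧ gammaMahlerCoeff 3 𝓛 0 = 0 ∧
      gammaCharValue 3 𝓛 (1 : DirichletCharacter ℂ_[3] (3 ^ 0)) = 0 ∧ 1 ≤ gammaOrderAtOne 3 𝓛 :=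
  vanishing_at_one η α 𝓛 h hadd hη (entireLFunction_one_eq_zero_of_analyticRank_eq_one hr)

/-- **Non-vanishing at `𝟙` in analytic rank `0`** (no exceptional zero): for `W` additive at `3`
with `L(W,1) ≠ 0`, `η` primitive mod `9`, `α ≠ 0`: `𝓛 0 0 ≠ 0`, so the order at `𝟙` is `0`.
[cite: MazurTateTeitelbaum1986Invent, §I.14 (case p ∣ N, a_p ≠ 0)] -/
theorem apply_zero_zero_ne_zero (h : IsPSCyclotomicLFunctionOf W η α 𝓛) (hadd : Addv W 3)
    (hη : η.IsPrimitive) (hα : α ≠ 0) (hL : W.entireLFunction 1 ≠ 0) :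
    𝓛 0 0 ≠ 0 ∧ gammaOrderAtOne 3 𝓛 = 0 := by
  have hne : 𝓛 0 0 ≠ 0 := fun h0 ↦ hL ((apply_zero_zero_eq_zero_iff η α 𝓛 h hadd hη hα).mp h0)
  refine ⟨hne, gammaOrderAtOne_eq_zero_of_coeff_zero_ne_zero ?_⟩
  rwa [gammaMahlerCoeff_zero h.isGammaDistribution_and_hasGrowthOrder.1]

end Curve

end Summit.BirchSwinnertonDyer.BirchSwinnertonDyer.Theorems.CyclotomicUntwistValueAtOne

end
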